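/-
Copyright (c) 2026 the pub-hodgecm-mathlib formalisation cell (harness21).  Prover seat hodgecm-mathlib-F0P2-p07 (g0), strike line L1
`stub_firstTermThetaPairing` (LEAD F0P6-plan (g14) BATCH #68 «F0P2-p07 = non-split evaluation»; composition HEAD BYTES 22:58Z): Track B «K2-LIT»,
hLiu418 = stmt-HodgeConjecture-24832, road `K2_Liu`, socket #42S, organ S1 ROAD W, (G) organ (ρ-mid): THE (C3) PHASE AT A SINGLE-ROW POINT, NON-SPLIT PLACE.
-/
import Literature.NumberTheory.GelbartRogawski1991.LocalDoubledUnitaryBigCellValue    -- ★ `gramS_map_conj`, `gramS_transpose`, `conjLocal_conjLocal'`, quadratic coordinates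
import Literature.NumberTheory.Automorphic.AnisotropicUnitaryGroupCompactOfPlace        -- ★ `conjLocal_apply_eq_of_smul_eq` (one place above a non-split `v`)
import Literature.NumberTheory.Automorphic.UnitaryGroupNonsplitPlace                    -- ★ `PlacesOver.subsingleton_of_smul_eq`
import Summits.HodgeConjecture.HodgeConjecture.Theorems.K2LiuDeltaSpTransportUnipotentValue   -- ★ `re_conjLocal`, `im_conjLocal` (σ ⊗ 1 in quadratic coordinates)
import HarnessLib

/-!
# Crux `HLiu418`, #42S organ S1, (G) organ (ρ-mid): THE (C3) PHASE `⅟2·im(2·tr(𝕊·t·G̃))` AT A SINGLE-ROW POINT OF THE MIDDLE CELL, NON-SPLIT PLACE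

Cell `hodgecm-mathlib`, crux item hLiu418 = `stmt-HodgeConjecture-24832`; squad K2 ∕ K2Liu; LEAD F0P6-plan (g14); (M2a) chain ★ (C3) p862499 → ★ (C3-d) `K2LiuTensorMiddleCellPhaseTrace`
(K2Liu-p08) → ★ (C3-c″) `K2LiuTensorMiddleCellPointRows` (K2Liu-p26) → THIS FILE → `K2LiuNonsplitMiddleProfileRowOfReading` (this seat) → ★ p862456.  THEOREMS ONLY
(no `def`, no instance, no notation, no named-fact hypothesis, no `sorry`); lane `--supports stmt-HodgeConjecture-24832 --as helper`.

WHY.  ★ (C3-d) `halfForm_cOfFix_boxConj_eq_half_im_trace` writes the phase of the (C3) Levi row as `ψ_v(−⅟2·im_Q(2·tr(𝕊 · t · G̃(z))))` with `G̃(z)` the hermitian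
Gram of the reading of the integration point `z = PD·(x₁ ⊔ 0)`; by ★ (C3-c″) `exists_pointRows` and the (K2) letter of the lattice-pair reading, `G̃(z)` read at the
unique place `w₀` above a NON-SPLIT `v` has the single entry `(i₀, i₀) = g₀ := ασβ + βσα + D₀γσγ`.  THIS FILE turns that into the `hrow` phase shape of ★ p862456
∕ ★ `K2LiuNonsplitTracePhase.tracePhase_eq_of_toPlace_eq`: **`⅟2·im(2·tr(𝕊·t·G̃)) = im((𝕊t)_{i₀i₀}) · re(G̃_{i₀i₀})`** with **`ι_{w₀}(re(G̃_{i₀i₀})) = g₀`**, so the phase is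
`ψ_v(s_t · q)`, `s_t := −im((𝕊t)_{i₀i₀})` (linear in `t` — the ramified `Ad(d_a)` letter), `ι_{w₀} q = g₀ = Z + σZ`, `Z = ασβ + (⅟2·D₀)γσγ`.  Generic quadratic `E/F`, `c`,
`δ` (`c δ = −δ ≠ 0`, `δ² = d`), any `n`, `T₀`; quadratic coordinates `Ψ_v = quadraticLocalEquiv` (★ `isQuadraticCoordinates_local`).
* §1 (over ★ `K2LiuDeltaSpTransportUnipotentValue.re_conjLocal`∕`im_conjLocal`) `re_eq_zero_of_conjLocal_eq_neg`, `im_eq_zero_of_conjLocal_eq_self`, `toLocalRing_re_of_conjLocal_eq_self` — `σ ⊗ 1` in coordinates;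
* §2 `conjLocal_gramS_mul_apply_diag` — for `𝕊`-skew `t`, the diagonal entries of `𝕊·t` are `σ`-odd; `half_im_two_mul_of_odd_even` — `⅟2·im(2·τ·g) = im τ · re g` for
  `σ`-odd `τ`, `σ`-even `g`;
* §3 `trace_mul_eq_of_offDiag_eq_zero` (one non-zero entry), and at a non-split place: `eq_zero_of_apply_place_eq_zero`, `offDiag_eq_zero_of_apply_place`,
  `conjLocal_eq_self_of_apply_place`, `galAdicCompletionMap_galAdicCompletionMap` (`σ_{w₀}` is an involution);
* §4 `vecMulVec_single_rows_apply` — the (K2) right-hand side at single rows `(α•e_{i₀}, β•e_{i₀}, γ•e_{i₀})` is `[j = i = i₀]·(ασβ + βσα + D₀γσγ)`; `hyperbolic_eq_add_conj`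
  (`ασβ + βσα + D₀γσγ = Z + σZ`);
* §5 **`half_im_two_trace_of_single_entry`** — the assembled statement consumed by the composition.
References: [Rangarao1993] Lemma 3.2 (3.8); [Kudla1994] §3 Thm. 3.1; [HarrisKudlaSweet1996] §1 (1.11); [Shimura1997] §13.2; [CasselsFrohlichANT1967] Ch. II §10.
HONEST LABEL.  Count-neutral helper; it retires nothing by itself: `HC_CM` is proved only modulo the 7 printed citations (2 remaining named inputs:
hLiu418 = `stmt-HodgeConjecture-24832`, h413 = `stmt-HodgeConjecture-24833`) until rung 0 closes.

## References
* [Rangarao1993] R. Ranga Rao, Pacific J. Math. 157 (1993), Lemma 3.2 (3.8), p. 351.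
* [Kudla1994] S. S. Kudla, Israel J. Math. 87 (1994), §3 Thm. 3.1.
* [HarrisKudlaSweet1996] M. Harris, S. S. Kudla, W. J. Sweet, J. Amer. Math. Soc. 9 (1996), §1 (1.11).
* [Shimura1997] G. Shimura, *Euler Products and Eisenstein Series*, CBMS 93 (1997), §13.2.
* [CasselsFrohlichANT1967] J. W. S. Cassels, A. Fröhlich (eds.), *Algebraic Number Theory* (1967), Ch. II §10.
-/

set_option autoImplicit false
set_option linter.dupNamespace false -- the mandated namespace repeats `HodgeConjecture.HodgeConjecture`

noncomputable section

open scoped Matrix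
open NumberField IsDedekindDomain Matrix
open Literature.NumberTheory.Automorphic Literature.NumberTheory.Automorphic.UnitaryGroup
open Literature.NumberTheory.Automorphic.UnitaryGroup.QuadraticCoordinates
open Literature.NumberTheory.GelbartRogawski1991.UnitaryDualPair Literature.NumberTheory.GelbartRogawski1991.UnitaryDualPair.LocalSplitting

namespace Summit.HodgeConjecture.HodgeConjecture.Cruxes.HLiu418.K2LiuNonsplitMiddleCellPhasePoint

variable (F : Type) [Field F] [NumberField F] (E : Type) [Field E] [NumberField E] [Algebra F E] [Algebra.IsQuadraticExtension F E]
  (c : E ≃ₐ[F] E) {δ : E} (hcδ : c δ = -δ) (hδ : δ ≠ 0) {d : F} (hd : δ * δ = algebraMap F E d)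
  (v : HeightOneSpectrum (𝓞 F))

/-! ## §1 `σ ⊗ 1` in the quadratic coordinates `x = ι(re x) + ι(im x)·δ̂` -/

/-- a `σ`-ODD element has `re = 0` (`2` is invertible in `F_v`). [cite: CasselsFrohlichANT1967, Ch. II §10] -/
theorem re_eq_zero_of_conjLocal_eq_neg [Invertible (2 : v.adicCompletion F)] {x : LocalRing E v} (hx : conjLocal E c v x = -x) :
    re (quadraticLocalEquiv E v c hcδ hδ).toLinearEquiv.toAddEquiv x = 0 := by
  have h1 := K2LiuDeltaSpTransportUnipotentValue.re_conjLocal F E c hcδ hδ v x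
  rw [hx, map_neg] at h1
  -- `-r = r` forces `r = 0`
  have h2 : (2 : v.adicCompletion F) * re (quadraticLocalEquiv E v c hcδ hδ).toLinearEquiv.toAddEquiv x = 0 := by linear_combination -h1
  have h3 := congrArg (fun y => ⅟(2 : v.adicCompletion F) * y) h2
  simpa only [← mul_assoc, invOf_mul_self, one_mul, mul_zero] using h3

/-- a `σ`-EVEN element has `im = 0`. [cite: CasselsFrohlichANT1967, Ch. II §10] -/
theorem im_eq_zero_of_conjLocal_eq_self [Invertible (2 : v.adicCompletion F)] {x : LocalRing E v} (hx : conjLocal E c v x = x) :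
    im (quadraticLocalEquiv E v c hcδ hδ).toLinearEquiv.toAddEquiv x = 0 := by
  have h1 := K2LiuDeltaSpTransportUnipotentValue.im_conjLocal F E c hcδ hδ v x
  rw [hx] at h1
  have h2 : (2 : v.adicCompletion F) * im (quadraticLocalEquiv E v c hcδ hδ).toLinearEquiv.toAddEquiv x = 0 := by linear_combination h1
  have h3 := congrArg (fun y => ⅟(2 : v.adicCompletion F) * y) h2
  simpa only [← mul_assoc, invOf_mul_self, one_mul, mul_zero] using h3

include hd in
/-- a `σ`-EVEN element descends: `ι_v(re x) = x`. [cite: CasselsFrohlichANT1967, Ch. II §10] -/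
theorem toLocalRing_re_of_conjLocal_eq_self [Invertible (2 : v.adicCompletion F)] {x : LocalRing E v} (hx : conjLocal E c v x = x) :
    toLocalRing E v (re (quadraticLocalEquiv E v c hcδ hδ).toLinearEquiv.toAddEquiv x) = x := by
  have h := isQuadraticCoordinates_local E v c hcδ hδ hd
  conv_rhs => rw [← h.re_add_im x]
  rw [im_eq_zero_of_conjLocal_eq_self F E c hcδ hδ v hx, map_zero, zero_mul, add_zero]

/-! ## §2 The unipotent letter: diagonal entries of `𝕊·t` are `σ`-odd; `⅟2·im(2·τ·g)` for odd `τ`, even `g` -/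

omit [Algebra.IsQuadraticExtension F E] in
/-- **for an `𝕊`-skew `t` the diagonal entries of `𝕊·t` are `σ`-odd**: `σ((𝕊t)_{ii}) = −(𝕊t)_{ii}` (`𝕊` is real symmetric: ★ `gramS_map_conj`, ★ `gramS_transpose`).
[cite: HarrisKudlaSweet1996, §1 (1.11)] [cite: Shimura1997, §13.2] -/
theorem conjLocal_gramS_mul_apply_diag {n : ℕ} {T₀ : Matrix (Fin n) (Fin n) F} (hT₀ : T₀.IsSymm) {t : Matrix (Fin n) (Fin n) (LocalRing E v)}
    (ht : (t.map (conjLocal E c v))ᵀ * gramS F E v n T₀ + gramS F E v n T₀ * t = 0) (i : Fin n) :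
    conjLocal E c v ((gramS F E v n T₀ * t) i i) = -(gramS F E v n T₀ * t) i i := by
  have hTr : (gramS F E v n T₀)ᵀ = gramS F E v n T₀ := gramS_transpose F E v n hT₀
  -- the `(i,i)` entry of the skew relation
  have h := congrFun (congrFun ht i) i
  rw [Matrix.add_apply, Matrix.zero_apply] at h
  -- `σ((𝕊t)ᵢᵢ) = ((σt)ᵀ 𝕊)ᵢᵢ`
  have hσ : conjLocal E c v ((gramS F E v n T₀ * t) i i) = ((t.map (conjLocal E c v))ᵀ * gramS F E v n T₀) i i := by
    rw [Matrix.mul_apply, Matrix.mul_apply, map_sum]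
    refine Finset.sum_congr rfl fun k _ => ?_
    rw [_root_.map_mul, Matrix.transpose_apply, Matrix.map_apply, mul_comm]
    congr 1
    · have hk := congrFun (congrFun (gramS_map_conj F E c v n (T₀ := T₀)) i) k
      rw [Matrix.map_apply] at hk
      rw [hk, ← hTr, Matrix.transpose_apply, hTr]
  rw [hσ]
  linear_combination h

include hd in
/-- **`⅟2 · im(2 · τ · g) = im τ · re g`** for `σ`-odd `τ` (`re τ = 0`) and `σ`-even `g` (`im g = 0`) (★ `IsQuadraticCoordinates.im_mul`).
[cite: Shimura1997, §13.2] [cite: CasselsFrohlichANT1967, Ch. II §10] -/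
theorem half_im_two_mul_of_odd_even [Invertible (2 : v.adicCompletion F)] {τ g : LocalRing E v} (hτ : conjLocal E c v τ = -τ) (hg : conjLocal E c v g = g) :
    ⅟(2 : v.adicCompletion F) * im (quadraticLocalEquiv E v c hcδ hδ).toLinearEquiv.toAddEquiv (2 * (τ * g)) =
      im (quadraticLocalEquiv E v c hcδ hδ).toLinearEquiv.toAddEquiv τ * re (quadraticLocalEquiv E v c hcδ hδ).toLinearEquiv.toAddEquiv g := by
  have h := isQuadraticCoordinates_local E v c hcδ hδ hd
  rw [two_mul, map_add, h.im_mul, re_eq_zero_of_conjLocal_eq_neg F E c hcδ hδ v hτ, im_eq_zero_of_conjLocal_eq_self F E c hcδ hδ v hg, zero_mul,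
    zero_add, ← two_mul, ← mul_assoc, invOf_mul_self, one_mul]

/-! ## §3 One non-zero entry; the unique place above a non-split `v` -/

/-- the trace against a matrix with a single non-zero entry `(i₀, i₀)`. [folklore] -/
theorem trace_mul_eq_of_offDiag_eq_zero {R : Type*} [CommRing R] {m : ℕ} (A G : Matrix (Fin m) (Fin m) R) (i₀ : Fin m)
    (hG : ∀ j i, ¬ (j = i₀ ∧ i = i₀) → G j i = 0) : Matrix.trace (A * G) = A i₀ i₀ * G i₀ i₀ := by
  rw [Matrix.trace]
  simp only [Matrix.diag_apply, Matrix.mul_apply]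
  rw [Finset.sum_eq_single i₀ (fun i _ hi => Finset.sum_eq_zero fun j _ => by rw [hG j i (fun h => hi h.2), mul_zero]) (fun h => (h (Finset.mem_univ _)).elim)]
  exact Finset.sum_eq_single i₀ (fun j _ hj => by rw [hG j i₀ (fun h => hj h.1), mul_zero]) (fun h => (h (Finset.mem_univ _)).elim)

section Nonsplit

variable (hc : c ≠ 1) (w₀ : PlacesOver E v) (hw₀ : c • w₀.1 = w₀.1)

include hc hw₀ in
/-- at a NON-SPLIT place an element of `E ⊗ F_v` vanishes iff its `w₀`-component does. [cite: CasselsFrohlichANT1967, Ch. II §10] -/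
theorem eq_zero_of_apply_place_eq_zero {x : LocalRing E v} (hx : x w₀ = 0) : x = 0 := by
  haveI : Subsingleton (PlacesOver E v) := PlacesOver.subsingleton_of_smul_eq c hc w₀ hw₀
  funext w
  obtain rfl : w = w₀ := Subsingleton.elim w w₀
  exact hx

include hc hw₀ in
/-- a matrix over `E ⊗ F_v` whose `w₀`-components vanish off `(i₀, i₀)` vanishes off `(i₀, i₀)`. [cite: CasselsFrohlichANT1967, Ch. II §10] -/
theorem offDiag_eq_zero_of_apply_place {m : ℕ} {G : Matrix (Fin m) (Fin m) (LocalRing E v)} {i₀ : Fin m} {g₀ : w₀.1.adicCompletion E}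
    (hG : ∀ j i, G j i w₀ = if j = i₀ ∧ i = i₀ then g₀ else 0) : ∀ j i, ¬ (j = i₀ ∧ i = i₀) → G j i = 0 := fun j i hji =>
  eq_zero_of_apply_place_eq_zero F E c v hc w₀ hw₀ (by rw [hG, if_neg hji])

include hcδ hδ hd hc hw₀ in
/-- **`σ_{w₀}` IS AN INVOLUTION** of `E_{w₀}` at a non-split place (★ `conjLocal_conjLocal'` read at the one place, ★ `conjLocal_apply_eq_of_smul_eq`).
[cite: CasselsFrohlichANT1967, Ch. II §10] -/
theorem galAdicCompletionMap_galAdicCompletionMap (z : w₀.1.adicCompletion E) :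
    galAdicCompletionMap (L := E) c hw₀ (galAdicCompletionMap (L := E) c hw₀ z) = z := by
  classical
  have h := congrFun (conjLocal_conjLocal' F E c hcδ hδ hd v (Pi.single w₀ z)) w₀
  rw [conjLocal_apply_eq_of_smul_eq c hc v w₀ hw₀, conjLocal_apply_eq_of_smul_eq c hc v w₀ hw₀, Pi.single_eq_same] at h
  exact h

include hc hw₀ in
/-- an element of `E ⊗ F_v` is `σ`-even iff its `w₀`-component is `σ_{w₀}`-even (non-split `v`). [cite: CasselsFrohlichANT1967, Ch. II §10] -/
theorem conjLocal_eq_self_of_apply_place {x : LocalRing E v} (hx : galAdicCompletionMap (L := E) c hw₀ (x w₀) = x w₀) : conjLocal E c v x = x := by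
  haveI : Subsingleton (PlacesOver E v) := PlacesOver.subsingleton_of_smul_eq c hc w₀ hw₀
  funext w
  obtain rfl : w = w₀ := Subsingleton.elim w w₀
  rw [conjLocal_apply_eq_of_smul_eq c hc v w hw₀]
  exact hx

end Nonsplit

/-! ## §4 The (K2) right-hand side at single rows -/

/-- **THE HYPERBOLIC GRAM AT SINGLE ROWS**: with `x₁ = α•e_{i₀}`, `x₂ = β•e_{i₀}`, `x₃ = γ•e_{i₀}`,
`(x₁ ⊗ σx₂ + x₂ ⊗ σx₁ + D₀ • x₃ ⊗ σx₃)_{ji} = [j = i₀ ∧ i = i₀] · (ασβ + βσα + D₀·γσγ)`. [cite: HarrisKudlaSweet1996, §1 (1.11)] [cite: Kudla1994, §3 Thm. 3.1] -/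
theorem vecMulVec_single_rows_apply {K : Type*} [CommRing K] (σ : K →+* K) (i₀ : Fin 2) (α β γ D₀ : K) (j i : Fin 2) :
    ((vecMulVec (α • Pi.single i₀ (1 : K)) (fun l => σ ((β • Pi.single i₀ (1 : K)) l)) +
        vecMulVec (β • Pi.single i₀ (1 : K)) (fun l => σ ((α • Pi.single i₀ (1 : K)) l)) +
        D₀ • vecMulVec (γ • Pi.single i₀ (1 : K)) (fun l => σ ((γ • Pi.single i₀ (1 : K)) l)) : Matrix (Fin 2) (Fin 2) K)) j i =
      if j = i₀ ∧ i = i₀ then α * σ β + β * σ α + D₀ * (γ * σ γ) else 0 := by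
  simp only [Matrix.add_apply, Matrix.smul_apply, Matrix.vecMulVec_apply, Pi.smul_apply, Pi.single_apply, smul_eq_mul, mul_ite, mul_one, mul_zero,
    apply_ite σ, map_zero, smul_eq_mul]
  by_cases hj : j = i₀ <;> by_cases hi : i = i₀ <;> simp [hj, hi]

/-- **`ασβ + βσα + D₀γσγ = Z + σZ`, `Z = ασβ + (⅟2·D₀)·γσγ`** for an involution `σ` fixing `D₀` (and `⅟2`). [cite: HarrisKudlaSweet1996, §1 (1.11)] -/
theorem hyperbolic_eq_add_conj {K : Type*} [CommRing K] [Invertible (2 : K)] (σ : K →+* K) (hσσ : ∀ z, σ (σ z) = z) {D₀ : K} (hD₀ : σ D₀ = D₀)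
    (h2 : σ (⅟(2 : K)) = ⅟(2 : K)) (α β γ : K) :
    α * σ β + β * σ α + D₀ * (γ * σ γ) = (α * σ β + ⅟(2 : K) * D₀ * γ * σ γ) + σ (α * σ β + ⅟(2 : K) * D₀ * γ * σ γ) := by
  simp only [map_add, map_mul, hσσ, hD₀, h2]
  have h22 : (⅟(2 : K) + ⅟(2 : K)) = 1 := by rw [← two_mul, mul_invOf_self]
  linear_combination (-(D₀ * γ * σ γ)) * h22

/-! ## §5 The assembled phase letter at a single-row point -/

include hd in
/-- **THE (C3) PHASE AT A SINGLE-ROW POINT, NON-SPLIT PLACE.**  For an `𝕊`-skew `t` and a matrix `G̃` over `E ⊗ F_v` whose `w₀`-components are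
`[j = i₀ ∧ i = i₀]·g₀` with `σ_{w₀} g₀ = g₀` (the hermitian Gram of a single-row point, §4 + the (K2) letter): `⅟2 · im_Q(2 · tr(𝕊 · t · G̃)) = im_Q((𝕊t)_{i₀i₀}) · re_Q(G̃_{i₀i₀})`
and `ι_{w₀}(re_Q(G̃_{i₀i₀})) = g₀` — the phase is `ψ_v(−im((𝕊t)_{i₀i₀}) · q)` with `ι_{w₀} q = g₀`.
[cite: Rangarao1993, Lemma 3.2 (3.8), p. 351] [cite: Kudla1994, §3 Thm. 3.1] [cite: Shimura1997, §13.2] -/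
theorem half_im_two_trace_of_single_entry [Invertible (2 : v.adicCompletion F)] (hc : c ≠ 1) (w₀ : PlacesOver E v) (hw₀ : c • w₀.1 = w₀.1)
    {n : ℕ} {T₀ : Matrix (Fin n) (Fin n) F} (hT₀ : T₀.IsSymm) {t : Matrix (Fin n) (Fin n) (LocalRing E v)}
    (ht : (t.map (conjLocal E c v))ᵀ * gramS F E v n T₀ + gramS F E v n T₀ * t = 0)
    (G : Matrix (Fin n) (Fin n) (LocalRing E v)) (i₀ : Fin n) {g₀ : w₀.1.adicCompletion E}
    (hG : ∀ j i, G j i w₀ = if j = i₀ ∧ i = i₀ then g₀ else 0) (hg₀ : galAdicCompletionMap (L := E) c hw₀ g₀ = g₀) :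
    ⅟(2 : v.adicCompletion F) * im (quadraticLocalEquiv E v c hcδ hδ).toLinearEquiv.toAddEquiv (2 * Matrix.trace (gramS F E v n T₀ * t * G)) =
        im (quadraticLocalEquiv E v c hcδ hδ).toLinearEquiv.toAddEquiv ((gramS F E v n T₀ * t) i₀ i₀) *
          re (quadraticLocalEquiv E v c hcδ hδ).toLinearEquiv.toAddEquiv (G i₀ i₀) ∧
      toPlace v w₀ (re (quadraticLocalEquiv E v c hcδ hδ).toLinearEquiv.toAddEquiv (G i₀ i₀)) = g₀ := by
  have hGi : G i₀ i₀ w₀ = g₀ := by rw [hG, if_pos ⟨rfl, rfl⟩]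
  have hGσ : conjLocal E c v (G i₀ i₀) = G i₀ i₀ :=
    conjLocal_eq_self_of_apply_place F E c v hc w₀ hw₀ (by rw [hGi]; exact hg₀)
  refine ⟨?_, ?_⟩
  · rw [trace_mul_eq_of_offDiag_eq_zero _ G i₀ (offDiag_eq_zero_of_apply_place F E c v hc w₀ hw₀ hG)]
    exact half_im_two_mul_of_odd_even F E c hcδ hδ hd v (conjLocal_gramS_mul_apply_diag F E c v hT₀ ht i₀) hGσ
  · have h := congrFun (toLocalRing_re_of_conjLocal_eq_self F E c hcδ hδ hd v hGσ) w₀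
    rw [toLocalRing_apply] at h
    rw [h, hGi]

end Summit.HodgeConjecture.HodgeConjecture.Cruxes.HLiu418.K2LiuNonsplitMiddleCellPhasePoint

end
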